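import Mathlib
import Summits.ABC.ABC.Theorems.PrimePowerRadical.Negative.NonWieferich

/-!
# Sketch (crux-ideate r2, ideator 4) — card `period-norm-parity` for crux stmt-ABC-1648 `PrimePowerRadical`

FIRST-LAYER PERIOD CRITERION. Let `p` be an odd prime, `T ⊂ (ℤ/p²)ˣ` the subgroup of order `p − 1`
(Teichmüller lifts), `K_p` the degree-`p` subfield of `ℚ(ζ_{p²})` (= first layer of the cyclotomic
`ℤ_p`-extension of `ℚ`, fixed field of `T`), `η_j = Σ_{t∈T} ζ_{p²}^{t(1+p)^j}` (`j = 0..p−1`) the Gauss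
periods (= Heilbronn sums) and `Ψ_p = ∏_j (x − η_j) ∈ ℤ[x]`.  For every prime `q ≠ p`:

  `q^{p−1} ≡ 1 (mod p²)`  ⟺  `q` splits completely in `K_p`  ⟺  `Ψ_p` has a root mod `q`
  ⟺  `q ∣ N_{K_p/ℚ}(η^q − η) = ∏_j (η_j^q − η_j)`;   otherwise `Ψ_p mod q` is IRREDUCIBLE of degree `p`.
  Base 2:  `p` is a Wieferich prime  ⟺  `N_{K_p/ℚ}(η) = ∏_j η_j` is even.

Everything is stated below inside the finite ring `(ℤ/q)[X]/(Φ_{p²}) = ℤ[ζ_{p²}]/q` (Mathlib: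
`AdjoinRoot (cyclotomic (p^2) (ZMod q))`), so no number-field API is needed to TYPE the line; the integer
`N_{K_p/ℚ}(η^q − η)` reduces to the displayed product, which lies in the image of `ℤ/q`.

PROOF (paper, this session; numerically verified: all `p ≤ 23` × `q ≤ 60`; base 2 for all `p < 260` and
`p ∈ {1091, 1093}` — `N(η_{1093})` is EVEN, scratch/period_norm_mod2.py, 62 s; kit jobs j020062/j020063 extend).
`K_p/ℚ` is cyclic of degree `p`, unramified at `q`, and `Frob_q = (q mod p²)·T ∈ (ℤ/p²)ˣ/T`, so `q` splits
completely iff `q mod p² ∈ T` iff `q^{p−1} ≡ 1 (p²)`; otherwise `q` is inert.  SPLIT: `𝓞_K/q ≅ 𝔽_q^p`,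
`η ↦ (a_i)`, `Ψ_p ≡ ∏ (x − a_i)` has roots and `η^q − η ∈ q𝓞_K`, so `q^p ∣ N(η^q − η)`.  INERT: `𝓞_K/q = 𝔽_{q^p}`;
if `η̄ ∈ 𝔽_q` then `η ≡ a (mod q𝓞_K)` for some `a ∈ ℤ`, hence `η_j − η_0 ∈ q𝓞_K ⊂ qℤ[ζ_{p²}]` — excluded by the
LEMMA below; so `η̄` has degree `p` over `𝔽_q`, `Ψ_p mod q` is its minimal polynomial (irreducible), and
`N(η^q − η) ≢ 0 (mod q)`.  BASE 2: `Tr η = 0`, so in the split case `#{i : a_i = 1}` is even, `#{i : a_i = 0}` is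
odd ≥ 1 and `N(η) ≡ ∏ a_i = 0 (mod 2)`; in the inert case `η̄ ≠ 0` in the field `𝔽_{2^p}`, so `N(η)` is odd.
LEMMA (`etaBar_ne`): for every prime `ℓ` and `0 < j < p`, `η_j − η_0 ∉ ℓ·ℤ[ζ_{p²}]`.  Proof: `Λ := span_ℤ{ζ^i :
0 ≤ i < p(p−1), p ∤ i} = ℤ[ζ_{p²}] ∩ ker Tr_{ℚ(ζ_{p²})/ℚ(ζ_p)}` is saturated and contains every primitive
`p²`-th root of unity (`ζ^{a+(p−1)p} = −Σ_{c≤p−2} ζ^{a+cp}`).  For `t ∈ T`, `t ≡ a (mod p)`, `t = a + c₀p`,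
`t(1+p)^j ≡ a + (c₀ + aj)p`, `c₁ := c₀ + aj ≢ c₀ (mod p)`; the fibre-`a` coordinates of `ζ^{t(1+p)^j} − ζ^t` are
`e_{c₁} − e_{c₀}`, `(−1,…,−1) − e_{c₀}` or `e_{c₁} + (1,…,1)`, each with an entry `±1` (as `p ≥ 3`), so
`η_j − η_0 ∉ ℓΛ = ℓℤ[ζ_{p²}] ∩ Λ_ℚ`. ∎
WALL TRANSFER: by `Negative.primePowerRadical_imp_infinite_nonWieferich` (p75728) every proof of the crux yields,
for every prime base, infinitely many non-Wieferich primes; in the new currency that mandatory stub reads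
"`Ψ_p` is irreducible mod `q` for infinitely many `p`" / (q = 2) "`N(η_p)` is odd for infinitely many `p`".
-/

noncomputable section

namespace Summit.ABC.ABC.Cruxes.PrimePowerRadical.PeriodNorm

open Literature.NumberTheory.DiophantineGeometry Polynomial

/-- Teichmüller set mod `p²`: residues `t ∈ [0, p²)` with `t^{p−1} ≡ 1 (mod p²)` (for `p` prime: the
`p − 1` lifts `a^p mod p²`, `a = 1..p−1`). -/
def teichSet (p : ℕ) : Finset ℕ :=
  (Finset.range (p ^ 2)).filter (fun t => t ^ (p - 1) ≡ 1 [MOD p ^ 2])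

/-- The finite ring `(ℤ/q)[X]/(Φ_{p²}(X)) = ℤ[ζ_{p²}]/q` in which the criterion is stated. -/
abbrev PeriodRing (p q : ℕ) : Type := AdjoinRoot (cyclotomic (p ^ 2) (ZMod q))

/-- The `j`-th conjugate first-layer Gauss period (Heilbronn sum) reduced mod `q`:
`η̄_j = Σ_{t ∈ T} ζ^{t (1+p)^j}` with `ζ = X mod Φ_{p²}`. -/
def etaBar (p q j : ℕ) : PeriodRing p q :=
  ∑ t ∈ teichSet p, (AdjoinRoot.root (cyclotomic (p ^ 2) (ZMod q))) ^ (t * (1 + p) ^ j)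

/-- NO-DEGENERACY LEMMA (the load-bearing new fact): distinct conjugate periods stay distinct modulo
every prime `ℓ`, i.e. `η_j − η_0 ∉ ℓ·ℤ[ζ_{p²}]` for `0 < j < p`. [this card; proof in the module docstring] -/
theorem etaBar_ne (p ℓ : ℕ) (hp : p.Prime) (hp2 : p ≠ 2) (hℓ : ℓ.Prime) (j : ℕ) (hj0 : 0 < j) (hjp : j < p) :
    etaBar p ℓ j ≠ etaBar p ℓ 0 := by
  sorry

/-- PERIOD CRITERION (first checkable statement of the line): for primes `p ≠ q`, `p` odd,
`q^{p−1} ≡ 1 (mod p²)` iff `N_{K_p/ℚ}(η^q − η) ≡ 0 (mod q)`, i.e. iff the first-layer period polynomial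
`Ψ_p` has a root mod `q`. [this card] -/
theorem isWieferich_iff_periodNorm (p q : ℕ) (hp : p.Prime) (hq : q.Prime) (hp2 : p ≠ 2) (hpq : p ≠ q) :
    IsWieferich q p ↔ (∏ j ∈ Finset.range p, ((etaBar p q j) ^ q - etaBar p q j)) = 0 := by
  sorry

/-- BASE 2: `p` is a Wieferich prime iff the norm of the first-layer Gauss period `∏_j η_j` is even
(uses `Tr η = 0`). Checked numerically for every `p < 260` and `p ∈ {1091, 1093}` (even exactly at 1093).
[this card] -/
theorem isWieferich_two_iff_periodNorm_even (p : ℕ) (hp : p.Prime) (hp2 : p ≠ 2) :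
    IsWieferich 2 p ↔ (∏ j ∈ Finset.range p, etaBar p 2 j) = 0 := by
  sorry

/-- WALL TRANSFER (base 2): infinitely many primes with odd period norm give infinitely many
non-Wieferich primes — the conclusion `PrimePowerRadical` is forced to produce
(`Negative.primePowerRadical_imp_infinite_nonWieferich`). Proved here from the criterion. -/
theorem infinite_nonWieferich_two_of_periodNorm
    (h : {p : ℕ | p.Prime ∧ (∏ j ∈ Finset.range p, etaBar p 2 j) ≠ 0}.Infinite) :
    {p : ℕ | p.Prime ∧ ¬ IsWieferich 2 p}.Infinite := by
  have hsub : {p : ℕ | p.Prime ∧ (∏ j ∈ Finset.range p, etaBar p 2 j) ≠ 0} ⊆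
      {p : ℕ | p.Prime ∧ ¬ IsWieferich 2 p} ∪ {2} := by
    intro p hp
    rcases hp with ⟨hpp, hne⟩
    by_cases h2 : p = 2
    · right; simp [h2]
    · left
      exact ⟨hpp, fun hw => hne ((isWieferich_two_iff_periodNorm_even p hpp h2).mp hw)⟩
  have hU : ({p : ℕ | p.Prime ∧ ¬ IsWieferich 2 p} ∪ {2}).Infinite := h.mono hsub
  rcases Set.infinite_union.mp hU with hA | hB
  · exact hA
  · exact absurd (Set.finite_singleton 2) hB

/-- WALL TRANSFER (general prime base `q`): infinitely many `p` with `Ψ_p` rootless mod `q` (period norm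
`N(η^q − η) ≢ 0`) give infinitely many non-Wieferich primes base `q`. Proved from the criterion. -/
theorem infinite_nonWieferich_of_periodNorm (q : ℕ) (hq : q.Prime)
    (h : {p : ℕ | p.Prime ∧ (∏ j ∈ Finset.range p, ((etaBar p q j) ^ q - etaBar p q j)) ≠ 0}.Infinite) :
    {p : ℕ | p.Prime ∧ ¬ IsWieferich q p}.Infinite := by
  have hsub : {p : ℕ | p.Prime ∧ (∏ j ∈ Finset.range p, ((etaBar p q j) ^ q - etaBar p q j)) ≠ 0} ⊆
      {p : ℕ | p.Prime ∧ ¬ IsWieferich q p} ∪ {2, q} := by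
    intro p hp
    rcases hp with ⟨hpp, hne⟩
    by_cases h2 : p = 2
    · right; simp [h2]
    · by_cases hpq : p = q
      · right; simp [hpq]
      · left
        exact ⟨hpp, fun hw => hne ((isWieferich_iff_periodNorm p q hpp hq h2 hpq).mp hw)⟩
  have hU : ({p : ℕ | p.Prime ∧ ¬ IsWieferich q p} ∪ {2, q}).Infinite := h.mono hsub
  rcases Set.infinite_union.mp hU with hA | hB
  · exact hA
  · exact absurd ((Set.finite_singleton q).insert 2) hB

end Summit.ABC.ABC.Cruxes.PrimePowerRadical.PeriodNorm
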